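import Summits.QuantumFields.YangMills.Theses.BackwardLiouvilleRigidity
import Summits.QuantumFields.YangMills.Theorems.BackwardLiouvilleRigidityBackwardChainLemmaAdmFR
import Summits.QuantumFields.YangMills.Theorems.BackwardLiouvilleRigidityBackwardStabilityAdmGronwall
import HarnessLib

/-!
# DRAFT skeleton (director-ym R606 ORDER (1), unstaffed at 23:30Z 2026-08-30) — LINE «backward-lyapunov» RE-KEYED to the
# R-n4 deciding crux `BackwardStabilityAdmFR` (stmt-QuantumFields-28294, route-QuantumFields-BackwardLiouvilleRigidity rev 19∕20)

Drafted by the width seat ym3-torus-px12 g20 (prover; NO registry verbs run — `ledger crux write` ∕ `ledger skeleton check --crux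
stmt-QuantumFields-28294` are the planner's∕operator's to run on these bytes if adopted).  It is the tree's skeleton
`Cruxes/FluctuationComparisonRegPrIntL/Lines/backward_stability_adm.lean` (ym-r3-idea-1 g13, for the aside 23331 `BackwardStabilityAdm`)
with the SAME two kernel-checked sufficient edges, re-keyed by exactly the route's 23331 → 28294 token edits (floor-class `η` clause
inserted after `Summable η`; membership `MemAtHeight … (ρ j)` ↦ `(∃ κ : ℝ, MemAtHeight … (fun U => Real.exp κ * ρ j U))`, twice):

* `stub_lyapunovFR` (XL) — the backward Lyapunov functional in free currency, hypotheses = 28294's VERBATIM, conclusion = g13's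
  (`∃ θ C w₀ ε δ j₁` with 28294's constant clauses incl. the floor class of `δ`, then `∀ J ≥ j₁, ∃ Φ ≥ 0, Φ J ≤ θ ω_J ∧ one-step
  inequality ∧ read-out of the one-bond oscillation`);
* `stub_gronwall` (M, LANDED ✓p664897 — by name);
* `stub_oneStepAdmFR : OneStepBackwardContractionAdmFR` (= crux stmt-QuantumFields-28296 BY NAME, XL);
* compositions `backwardStabilityAdmFR_of_stubs` (Lyapunov ∘ Grönwall) and `backwardStabilityAdmFR_of_oneStep` (= the landed chain
  ✓p788721 `backwardLiouvilleRigidity_backwardChainLemmaAdmFR_proof`), both concluding the crux BY NAME.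

Scoping of record (px12 g20 ✓p793226∕✓p794755 `Theorems/BackwardLiouvilleRigidityAdmFRTopHeight.lean`): the crux is vacuous on non-merging
pairs, trivial on floor-class-merging pairs, free at `j = J` — `stub_lyapunovFR`'s content is the backward propagation `j < J` for
subsequence-merging pairs.  Frame non-vacuity of record: ✓p791698∕✓p791874∕✓p792416 (the Wilson runs at their finest level inhabit the
∃κ frame at every height; admissibility alone does not).  Sorries ONLY inside `stub_*` (2: lyapunovFR XL, oneStepAdmFR = 28296).
No summit, rung or crux is proved here; `YM3TorusSU2` is NOT proved; the Yang–Mills mass gap is NOT proved.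
-/

set_option autoImplicit false

namespace Summit.QuantumFields.YangMills.Cruxes.BackwardStabilityAdmFR.BackwardLyapunov

open Summit.QuantumFields.YangMills.Theses.BackwardLiouvilleRigidity
open scoped BigOperators Topology
open Filter MeasureTheory

/-- stub (XL, K-row ∕ INSTRUMENT): a backward Lyapunov functional in free currency for admissible class trajectory pairs — g13's
`stub_lyapunov` with the 23331 → 28294 re-key (floor-class tails, ∃κ-membership). -/
theorem stub_lyapunovFR : open MeasureTheory Filter Topology Literature.MathematicalPhysics.QuantumFieldTheory.Balaban1983to89 T3ContinuumYM3Torus T3NestedUnitLaws T3UnitLawDensityEML T4Continuum BalabanUVClass T3UnitScaleTilt in ∃ γ₁ : ℝ, 0 < γ₁ ∧ ∀ (F : T3Family) (γ : ℝ), 0 < γ → γ ≤ γ₁ → ∀ (b₀ p₀ κ : ℝ) (j₀ : ℕ) (prm : ℕ → ClassParams) (ω η : ℕ → ℝ), 0 < b₀ → 0 < p₀ → AdmissibleClassParams F γ b₀ p₀ prm → 0 < κ → (∀ j, 0 ≤ ω j ∧ 0 ≤ η j) → Summable η → Summable (fun i => ∑' k, η (k + i)) → Tendsto (fun j => (∑'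 k, η (k + j)) * ((1 + 2 * ((F.L : ℝ) ^ j / γ) * (Fintype.card (Plaq (F.P j) 0) : ℝ)) * (Fintype.card (PBond (F.P j) 0) : ℝ) ^ 2)) atTop (𝓝 0) → ∀ (μ μ' : ((j : ℕ) → MeasureTheory.Measure (GaugeField (F.P j) 0 ↥(Matrix.specialUnitaryGroup (Fin 2) ℂ)))) (ρ ρ' : ((j : ℕ) → GaugeField (F.P j) 0 ↥(Matrix.specialUnitaryGroup (Fin 2) ℂ) → ℝ)), (∀ j : ℕ, IsProbabilityMeasure (μ j) ∧ μ j = Measure.map (descend F ℰp j) (μ (j + 1))) → (∀ j : ℕ, IsProbabilityMeasure (μ' j) ∧ μ' j = Measure.map (descend F ℰp j) (μ' (j + 1))) → (∀ j : ℕ, j₀ ≤ j → ((∀ U, PlaqSmall (θBal F.L γ b₀ p₀ j) U → 0 < ρ j U ∧ 0 < ρ' j U) ∧ μ j = (fieldMeasure _ _ _).withDensity (fun U => ENNReal.ofReal (ρ j U)) ∧ μ' j = (fieldMeasure _ _ _).withDensity (fun U => ENNReal.ofReal (ρ' j U)) ∧ (∃ κ : ℝ, MemAtHeight F ℰp j (prm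 j) (fun U => Real.exp κ * ρ j U)) ∧ (∃ κ : ℝ, MemAtHeight F ℰp j (prm j) (fun U => Real.exp κ * ρ' j U)) ∧ (∀ (b b' : PBond (F.P j) 0) U V W Z, PlaqSmall (θBal F.L γ b₀ p₀ j) U → PlaqSmall (θBal F.L γ b₀ p₀ j) V → PlaqSmall (θBal F.L γ b₀ p₀ j) W → PlaqSmall (θBal F.L γ b₀ p₀ j) Z → (∀ e, e ≠ b → U e = V e) → (∀ e, e ≠ b' → U e = W e) → (∀ e, e ≠ b' → V e = Z e) → (∀ e, e ≠ b → W e = Z e) → |(Real.log (ρ j U) - Real.log (ρ' j U)) - (Real.log (ρ j V) - Real.log (ρ' j V)) - ((Real.log (ρ j W) - Real.log (ρ' j W)) - (Real.log (ρ j Z) - Real.log (ρ' j Z)))| ≤ ω j * Real.exp (-(κ * (b.src.tdist b'.src : ℝ)))) ∧ μ j {U | ¬ PlaqSmall (θBal F.L γ b₀ p₀ j) U} ≤ ENNReal.ofReal (η j) ∧ μ' j {U | ¬ PlaqSmall (θBal F.L γ b₀ p₀ j) U} ≤ ENNReal.ofReal (η j) ∧ (ContinuousOn (ρ j) {U | PlaqSmall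 (θBal F.L γ b₀ p₀ j) U} ∧ ContinuousOn (ρ' j) {U | PlaqSmall (θBal F.L γ b₀ p₀ j) U}))) → ∃ (θ C w₀ : ℝ) (ε δ : ℕ → ℝ) (j₁ : ℕ), 0 < θ ∧ 0 ≤ C ∧ 0 < w₀ ∧ (∀ j, 0 ≤ ε j ∧ 0 ≤ δ j) ∧ Summable ε ∧ Summable δ ∧ Summable (fun i => ∑' k, δ (k + i)) ∧ Tendsto (fun j => (∑' k, δ (k + j)) * ((1 + 2 * ((F.L : ℝ) ^ j / γ) * (Fintype.card (Plaq (F.P j) 0) : ℝ)) * (Fintype.card (PBond (F.P j) 0) : ℝ) ^ 2)) atTop (𝓝 0) ∧ j₀ ≤ j₁ ∧ ∀ J : ℕ, j₁ ≤ J → ∃ Φ : ℕ → ℝ, (∀ j, 0 ≤ Φ j) ∧ Φ J ≤ θ * ω J ∧ (∀ j : ℕ, j₁ ≤ j → j < J → Φ (j + 1) ≤ w₀ → Φ j ≤ (1 + ε j + C * Φ (j + 1)) * Φ (j + 1) + δ j) ∧ (∀ j : ℕ, j₁ ≤ j → j ≤ J → ∀ (b : PBond (F.P j) 0) U V, PlaqSmall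 (θBal F.L γ b₀ p₀ j) U → PlaqSmall (θBal F.L γ b₀ p₀ j) V → (∀ e, e ≠ b → U e = V e) → |(Real.log (ρ j U) - Real.log (ρ' j U)) - (Real.log (ρ j V) - Real.log (ρ' j V))| ≤ Φ j * (1 / θ + 2 * ((F.L : ℝ) ^ j / γ) * (Fintype.card (Plaq (F.P j) 0) : ℝ))) := by
  sorry

/-- (LANDED ✓p664897, `Theorems/BackwardLiouvilleRigidityBackwardStabilityAdmGronwall.lean` — by name.) stub (M): discrete backward
Grönwall chain with `V_i := Φ i`, `v := θ ω_J`. -/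
theorem stub_gronwall : ∀ (C w₀ : ℝ) (ε δ Φ : ℕ → ℝ) (v : ℝ) (j₁ J : ℕ), 0 ≤ C → (∀ j, 0 ≤ ε j ∧ 0 ≤ δ j) → Summable ε → Summable δ → Summable (fun i => ∑' k, δ (k + i)) → (∀ j, 0 ≤ Φ j) → 0 ≤ v → Φ J ≤ v → (∀ j : ℕ, j₁ ≤ j → j < J → Φ (j + 1) ≤ w₀ → Φ j ≤ (1 + ε j + C * Φ (j + 1)) * Φ (j + 1) + δ j) → ∀ j : ℕ, j₁ ≤ j → j ≤ J → Real.exp (∑' k, ε k + 1) * (v + (∑' k, δ (k + j))) ≤ w₀ → C * (Real.exp (∑' k, ε k + 1) * ((J : ℝ) * v + (∑' i, ∑' k, δ (k + (i + j))))) ≤ 1 → Φ j ≤ Real.exp (∑' k, ε k + 1) * (v + (∑' k, δ (k + j))) :=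
  Summit.QuantumFields.YangMills.Theorems.BackwardLiouvilleRigidity.BackwardLyapunov.stub_gronwall

/-- stub (= crux item stmt-QuantumFields-28296 BY NAME, XL): the one-step organ — the STRONGER sufficient edge. -/
theorem stub_oneStepAdmFR : OneStepBackwardContractionAdmFR := by
  sorry

/-- COMPOSITION (kernel-checked): LINE «backward-lyapunov» concludes the crux `BackwardStabilityAdmFR` BY NAME. -/
theorem backwardStabilityAdmFR_of_stubs :
    Summit.QuantumFields.YangMills.Theses.BackwardLiouvilleRigidity.BackwardStabilityAdmFR := by
  classical
  obtain ⟨γ₁, hγ₁, h1⟩ := stub_lyapunovFR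
  refine ⟨γ₁, hγ₁, fun F γ hγ hle b₀ p₀ κ j₀ prm ω η hb₀ hp₀ hadm hκ hpos hη hηt hηf μ μ' ρ ρ' hc hc' hB => ?_⟩
  obtain ⟨θ, C, w₀, ε, δ, j₁, hθ, hC, hw₀, hεδ, hεs, hδs, hDs, hdec, hj₀₁, hly⟩ :=
    h1 F γ hγ hle b₀ p₀ κ j₀ prm ω η hb₀ hp₀ hadm hκ hpos hη hηt hηf μ μ' ρ ρ' hc hc' hB
  refine ⟨θ, C, w₀, ε, δ, j₁, hθ, hC, hw₀, hεδ, hεs, hδs, hDs, hdec, hj₀₁,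
    fun j J hj hJj hsmall hquad b U V hU hV hUV => ?_⟩
  obtain ⟨Φ, hΦnn, hΦtop, hΦstep, hΦread⟩ := hly J (le_trans hj hJj)
  have hv0 : 0 ≤ θ * ω J := mul_nonneg hθ.le (hpos J).1
  have hΦj : Φ j ≤ Real.exp (∑' k, ε k + 1) * (θ * ω J + (∑' k, δ (k + j))) :=
    stub_gronwall C w₀ ε δ Φ (θ * ω J) j₁ J hC hεδ hεs hδs hDs hΦnn hv0 hΦtop hΦstep j hj hJj hsmall hquad
  have hfac : 0 ≤ (1 / θ + 2 * ((F.L : ℝ) ^ j / γ) *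
      (Fintype.card (Literature.MathematicalPhysics.QuantumFieldTheory.Balaban1983to89.Plaq (F.P j) 0) : ℝ)) := by
    positivity
  exact (hΦread j hj hJj b U V hU hV hUV).trans (mul_le_mul_of_nonneg_right hΦj hfac)

/-- SECOND SUFFICIENT EDGE (kernel-checked, = ✓p788721): the one-step organ (crux 28296) implies the chained organ. -/
theorem backwardStabilityAdmFR_of_oneStep :
    Summit.QuantumFields.YangMills.Theses.BackwardLiouvilleRigidity.BackwardStabilityAdmFR :=
  Summit.QuantumFields.YangMills.Theorems.backwardLiouvilleRigidity_backwardChainLemmaAdmFR_proof stub_oneStepAdmFR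

/-- The crux, from the line's stubs (gate form `<CruxDecl>_of`). -/
theorem BackwardStabilityAdmFR_of :
    Summit.QuantumFields.YangMills.Theses.BackwardLiouvilleRigidity.BackwardStabilityAdmFR :=
  backwardStabilityAdmFR_of_stubs

end Summit.QuantumFields.YangMills.Cruxes.BackwardStabilityAdmFR.BackwardLyapunov
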